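import Summits.QuantumFields.YangMills.Theorems.F4SubCurvatureDoorShortRootRigidityTorusSliceAlgebra
import Summits.QuantumFields.YangMills.Theorems.F4SubCurvatureDoorShortRootRigidityTorusSlice3
import Summits.QuantumFields.YangMills.Theorems.F4SubCurvatureDoorShortRootRigidityTorusGenerator
import Summits.QuantumFields.YangMills.Theorems.F4SubCurvatureDoorShortRootRigidityTorusTransverse
import Summits.QuantumFields.YangMills.Theorems.F4SubCurvatureDoorShortRootRigidityTrigonalSectoralSpan
import Summits.QuantumFields.YangMills.Theorems.F4SubCurvatureDoorTransverseSliceGeometry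
import Summits.QuantumFields.YangMills.Theorems.F4SubCurvatureDoorMirrorContinuation
import Summits.QuantumFields.YangMills.Theorems.F4SubCurvatureDoorChamberSorting
import Mathlib
import HarnessLib

/-!
# TorusReduction, part (TR5): `NoBadModes L` for every `L` (unfolded form)

Crux ⟨stmt-QuantumFields-23035⟩ `F4SubCurvatureDoor.ShortRootRigidity`, stub `:146 stub_oddModeRigidity`, piece `TorusReduction`
(`Cruxes/ShortRootRigidity/Lines/odd_mode_split.lean`).  THE THEOREM (`noBadModes_unfolded`): a harmonic homogeneous polynomial `h` of
degree `L` on `ℝ⁴` which is invariant under the signed permutations `W(B₄)` and whose kernel is even-part slice-invariant along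
`Π₀ = span(e₀, (0,1,1,1)/√3)` is `O(4)`-invariant — stated with the split vocabulary unfolded (`pev = toFun`, `Σ∂ᵢ∂ᵢ = lap`), i.e. exactly
the hypothesis `hNB` of ✓`isometry_invariant_of_noBadModes` (frs-p2's analytic half).

Assembly of the route (all pieces in the tree): `L = 0` — constants; `L` odd — `−1 ∈ W(B₄)` and homogeneity give `h = 0`; `L = 2K ≥ 2` —
the slice `h₀ = h|_{x₀=0}` is homogeneous and `O_h`-invariant (`ohInvariant_slice`: spatial permutations and mirrors are signed
permutations of `ℝ⁴`), `h` is even in `x₀` (time reflection), the support condition kills the rational rotation generator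
(✓`generator_eq_zero`) whose `x₀¹`-coefficient is the 3D PDE (✓`slice_pde_of_generator`), so ✓`slice_eq_zero` (with ✓`trigonalInjectivityQ_holds`
and ✓`transverse_harmonic_eq_zero`) gives `h₀ = 0`, and CK uniqueness (✓`eq_zero_of_harmonic_of_coeff_zero_one`, the `x₀¹`-layer vanishing by
evenness) gives `h = 0`.

Mathlib + tree only; no `sorry`; no new definitions.  HONEST LABEL: with ✓AnalyticHalf (unfolded) this yields `OddModeRigidity` (stub `:146`, by
name in the companion file over the registered vocabulary); crux ⟨23035⟩ closes only when its skeleton is landed sorry-free; ⟨23125⟩, R2d and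
the Yang–Mills mass gap remain OPEN; no summit is proved by a line.  LEAD seat `ym-line-sfw-p2` g76 (cell ym-idea-1, free hands).
-/

noncomputable section

open MvPolynomial
open scoped BigOperators

namespace Summit.QuantumFields.YangMills.Theorems.F4SubCurvatureDoorTorus

open Literature.Analysis.Calculus.MvPoly (lap toFun toFun_apply toFun_smul_of_isHomogeneous)
open Literature.Algebra.Polynomial (linSubst eval_bind₁_linSubst laplacian_bind₁_linSubst)
open Literature.MathematicalPhysics.QuantumLattice (timeReflection timeReflection_apply)
open Summit.QuantumFields.YangMills.Cruxes.OSLegsAtWeakCouplingC.Sketch (IsSignedPerm)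
open Summit.QuantumFields.YangMills.Theorems.F4SubCurvatureDoorMirrorAnalyticityRegistered (E4)
open Summit.QuantumFields.YangMills.Theorems.F4SubCurvatureDoorSliceDensityRegistered (EvenPartSliceInvariant)
open Summit.QuantumFields.YangMills.Theorems.F4SubCurvatureDoorTrigonalLine (P3 Rf J3 flipMat OhInvariant Rf_mulVec)
open Summit.QuantumFields.YangMills.Theorems.F4SubCurvatureDoorGlobalReduction (reflection_single_apply isSignedPerm_reflection_single
  isSignedPerm_piLpCongrLeft isSignedPerm_neg)
open Summit.QuantumFields.YangMills.Theorems.F4SubCurvatureDoorSliceInClass (isSignedPerm_timeReflection)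
open Summit.QuantumFields.YangMills.Theorems.F4SubCurvatureDoorTrigonalSectoralSpan (trigonalInjectivityQ_holds)
open Summit.QuantumFields.YangMills.Theorems.F4SubCurvatureDoorTorusTransverse (transverse_harmonic_eq_zero)

/-! ## From signed-permutation invariance of the kernel to polynomial symmetries -/

/-- Evaluation at a plain coordinate vector is the kernel at the corresponding point of `E4`. -/
theorem eval_eq_toFun (h : MvPolynomial (Fin 4) ℝ) (v : Fin 4 → ℝ) : eval v h = toFun h (WithLp.toLp 2 v) := by
  rw [toFun_apply]

/-- **Time-evenness** of a signed-permutation invariant kernel: `h(−x₀, x⃗) = h(x₀, x⃗)`. -/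
theorem timeEven_of_signedPerm (h : MvPolynomial (Fin 4) ℝ)
    (hperm : ∀ R : E4 ≃ₗᵢ[ℝ] E4, IsSignedPerm R → ∀ x : E4, toFun h (R x) = toFun h x) (v : Fin 4 → ℝ) :
    eval (fun i => if i = 0 then -v i else v i) h = eval v h := by
  rw [eval_eq_toFun, eval_eq_toFun, ← hperm (timeReflection 4) isSignedPerm_timeReflection (WithLp.toLp 2 v)]
  congr 1
  ext i
  rw [timeReflection_apply]

/-- Sign reversal of a signed-permutation invariant kernel: `h(−x) = h(x)`. -/
theorem neg_even_of_signedPerm (h : MvPolynomial (Fin 4) ℝ)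
    (hperm : ∀ R : E4 ≃ₗᵢ[ℝ] E4, IsSignedPerm R → ∀ x : E4, toFun h (R x) = toFun h x) (x : E4) :
    toFun h (-x) = toFun h x := by
  rw [← hperm (LinearIsometryEquiv.neg ℝ) isSignedPerm_neg x]
  rfl

/-- **The slice inherits `O_h`**: spatial coordinate permutations and spatial mirrors of `ℝ⁴` are signed permutations fixing the slice
`x₀ = 0`, so `h|_{x₀=0}` is `OhInvariant`. -/
theorem ohInvariant_slice (h : MvPolynomial (Fin 4) ℝ)
    (hperm : ∀ R : E4 ≃ₗᵢ[ℝ] E4, IsSignedPerm R → ∀ x : E4, toFun h (R x) = toFun h x) :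
    OhInvariant ((finSuccEquiv ℝ 3 h).coeff 0) := by
  refine ⟨fun σ => ?_, fun i => ?_⟩
  · -- permutations: lift `σ` to a permutation of `Fin 4` fixing `0`
    refine MvPolynomial.funext fun y => ?_
    rw [eval_rename, eval_coeff_zero, eval_coeff_zero, eval_eq_toFun, eval_eq_toFun]
    set e : Equiv.Perm (Fin 4) := Equiv.Perm.decomposeFin.symm (0, σ) with he
    have he0 : e 0 = 0 := Equiv.Perm.decomposeFin_symm_apply_zero 0 σ
    have hes : ∀ j : Fin 3, e (Fin.succ j) = Fin.succ (σ j) := fun j => by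
      rw [he, Equiv.Perm.decomposeFin_symm_apply_succ, Equiv.swap_self, Equiv.refl_apply]
    rw [← hperm (LinearIsometryEquiv.piLpCongrLeft 2 ℝ ℝ e.symm) (isSignedPerm_piLpCongrLeft e.symm)
      (WithLp.toLp 2 (Fin.cons 0 y : Fin 4 → ℝ))]
    congr 1
    ext i
    rw [LinearIsometryEquiv.piLpCongrLeft_apply, Equiv.piCongrLeft'_apply, Equiv.symm_symm]
    refine Fin.cases ?_ (fun j => ?_) i
    · simp [he0]
    · simp [hes]
  · -- mirrors: the reflection in the coordinate `i+1`
    refine MvPolynomial.funext fun y => ?_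
    rw [eval_bind₁_linSubst, flipMat_mulVec, eval_coeff_zero, eval_coeff_zero, eval_eq_toFun, eval_eq_toFun,
      ← hperm _ (isSignedPerm_reflection_single (Fin.succ i)) (WithLp.toLp 2 (Fin.cons 0 y : Fin 4 → ℝ))]
    congr 1
    ext k
    rw [reflection_single_apply]
    refine Fin.cases ?_ (fun j => ?_) k
    · simp
    · by_cases hj : j = i
      · subst hj; simp
      · simp [hj, (Fin.succ_injective 3).ne hj]

/-! ## The block matrix `1 ⊕ Rf` -/

/-- The block matrix `S = 1 ⊕ Rf` acts as `(t, x⃗) ↦ (t, Rf x⃗)`. -/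
theorem blockRf_mulVec (t : ℝ) (v : Fin 3 → ℝ) :
    (!![1, 0, 0, 0; 0, 1/3, -2/3, -2/3; 0, -2/3, 1/3, -2/3; 0, -2/3, -2/3, 1/3] : Matrix (Fin 4) (Fin 4) ℝ).mulVec (Fin.cons t v) =
      Fin.cons t (Rf.mulVec v) := by
  rw [Rf_mulVec]
  have e0 : ∀ w : Fin 3 → ℝ, (Fin.cons t w : Fin 4 → ℝ) 0 = t := fun w => rfl
  have e1 : ∀ w : Fin 3 → ℝ, (Fin.cons t w : Fin 4 → ℝ) 1 = w 0 := fun w => rfl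
  have e2 : ∀ w : Fin 3 → ℝ, (Fin.cons t w : Fin 4 → ℝ) 2 = w 1 := fun w => rfl
  have e3 : ∀ w : Fin 3 → ℝ, (Fin.cons t w : Fin 4 → ℝ) 3 = w 2 := fun w => rfl
  funext i
  fin_cases i <;> simp [Matrix.mulVec, dotProduct, Fin.sum_univ_four, e0, e1, e2, e3] <;> ring

/-- `S = 1 ⊕ Rf` has orthonormal rows. -/
theorem blockRf_mul_transpose :
    (!![1, 0, 0, 0; 0, 1/3, -2/3, -2/3; 0, -2/3, 1/3, -2/3; 0, -2/3, -2/3, 1/3] : Matrix (Fin 4) (Fin 4) ℝ) *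
      (!![1, 0, 0, 0; 0, 1/3, -2/3, -2/3; 0, -2/3, 1/3, -2/3; 0, -2/3, -2/3, 1/3] : Matrix (Fin 4) (Fin 4) ℝ).transpose = 1 := by
  ext i j
  fin_cases i <;> fin_cases j <;> simp [Matrix.mul_apply, Fin.sum_univ_four] <;> norm_num

/-! ## `NoBadModes L` for every `L` -/

/-- **NoBadModes, all degrees (unfolded form).**  A harmonic homogeneous polynomial of degree `L` on `ℝ⁴`, invariant under the signed
permutations and with even part slice-invariant along `Π₀`, is invariant under every linear isometry of `ℝ⁴`. -/
theorem noBadModes_unfolded (L : ℕ) (h : MvPolynomial (Fin 4) ℝ) (hhom : h.IsHomogeneous L) (hharm : lap h = 0)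
    (hperm : ∀ R : E4 ≃ₗᵢ[ℝ] E4, IsSignedPerm R → ∀ x : E4, toFun h (R x) = toFun h x)
    (hE : EvenPartSliceInvariant (toFun h)) : ∀ (R : E4 ≃ₗᵢ[ℝ] E4) (x : E4), toFun h (R x) = toFun h x := by
  -- degree `0`: constants
  rcases Nat.eq_zero_or_pos L with rfl | hLpos
  · intro R x
    have hc : h = C (coeff 0 h) := by
      have := hhom.totalDegree_le
      exact (totalDegree_eq_zero_iff_eq_C).mp (Nat.le_zero.mp this)
    rw [hc, Literature.Analysis.Calculus.MvPoly.toFun_C, Literature.Analysis.Calculus.MvPoly.toFun_C]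
  -- positive degree: we show `h = 0`
  suffices hzero : h = 0 by
    intro R x; simp [hzero]
  rcases Nat.even_or_odd L with ⟨K, hK⟩ | hodd
  · -- even degree `L = 2K`, `K ≥ 1`: the TorusReduction route
    have hK2 : L = 2 * K := by omega
    have hK1 : 1 ≤ K := by omega
    subst hK2
    set S : Matrix (Fin 4) (Fin 4) ℝ :=
      !![1, 0, 0, 0; 0, 1/3, -2/3, -2/3; 0, -2/3, 1/3, -2/3; 0, -2/3, -2/3, 1/3] with hSdef
    have hS : ∀ (t : ℝ) (v : Fin 3 → ℝ), S.mulVec (Fin.cons t v) = Fin.cons t (Rf.mulVec v) := blockRf_mulVec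
    have hτ : ∀ v : Fin 4 → ℝ, eval (fun i => if i = 0 then -v i else v i) h = eval v h := timeEven_of_signedPerm h hperm
    -- the symmetrised polynomial `A = h + h∘σ̂` is harmonic and killed by the generator
    set A : MvPolynomial (Fin 4) ℝ := h + bind₁ (linSubst S) h with hA
    have hharm' : ∑ i : Fin 4, pderiv i (pderiv i h) = 0 := hharm
    have hAharm : ∑ i : Fin 4, pderiv i (pderiv i A) = 0 := by
      rw [hA]
      simp only [map_add, Finset.sum_add_distrib]
      rw [hharm', laplacian_bind₁_linSubst S blockRf_mul_transpose h, hharm', map_zero, add_zero]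
    have hgen := generator_eq_zero h S hS hτ hE
    have hpde := slice_pde_of_generator A hAharm hgen
    -- the slice `h₀` and the symmetrised slice
    set h₀ : P3 := (finSuccEquiv ℝ 3 h).coeff 0 with hh₀
    have hslice : (finSuccEquiv ℝ 3 A).coeff 0 = h₀ + bind₁ (linSubst Rf) h₀ := by
      rw [hA, map_add, Polynomial.coeff_add, coeff_zero_bind₁_linSubst h S Rf hS]
    rw [hslice] at hpde
    -- the 3D theorem
    have hh0 : h₀ = 0 :=
      slice_eq_zero K hK1 h₀ (isHomogeneous_coeff_zero hhom) (ohInvariant_slice h hperm) hpde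
        (fun s hs => trigonalInjectivityQ_holds s hs)
        (fun n Y hn1 hn3 hY hlap hD hp => transverse_harmonic_eq_zero n hn1 hn3 Y hY hlap hD hp)
    -- CK uniqueness
    exact eq_zero_of_harmonic_of_coeff_zero_one h hharm hh0 (coeff_one_eq_zero_of_even h hτ)
  · -- odd degree: `h(−x) = −h(x) = h(x)`
    refine MvPolynomial.funext fun v => ?_
    rw [map_zero, eval_eq_toFun]
    have h1 := neg_even_of_signedPerm h hperm (WithLp.toLp 2 v)
    rw [show -(WithLp.toLp 2 v : E4) = (-1 : ℝ) • (WithLp.toLp 2 v : E4) by simp, toFun_smul_of_isHomogeneous hhom,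
      hodd.neg_one_pow] at h1
    linarith

end Summit.QuantumFields.YangMills.Theorems.F4SubCurvatureDoorTorus

end
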